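import Literature.NumberTheory.Transcendental.KZMellinFibres
import Summits.KontsevichZagierPeriods.KontsevichZagierPeriods.Theorems.DasGapTwelve.Negative.LoadBearing

/-!
# `DasGapTwelve`, line `picard-involution-quotient`: stub E, the entry substitution `x = t³`

Stub `stub_cubeSubstitution` of the crux `DasGapTwelve` (stmt-KontsevichZagierPeriods-13215, route
TerasomaMultiplication). The crux's left representation `r = [(0,1), x^(-11/12) (1-x)^(-3/4)]`
(value `B(1/12,1/4)`) is KZ-equivalent, by ONE change-of-variables move (Kontsevich–Zagier rule (2))
along the Kummer covering `Φ = KZ.boxDilation 0 2 : t ↦ t³` of `(0,1)`, to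
`ρ₁ = [(0,1), 3 (t − t⁴)^(−3/4)]`, a period of the Picard curve `v⁴ = t − t⁴`:
`x^(-11/12) (1-x)^(-3/4) |_{x = t³} · 3t² = 3 t^(-11/4 + 2) (1 − t³)^(-3/4) = 3 (t (1 − t³))^(-3/4)`.

* `cubeSubst_base_pos`, `cubeSubst_kernel_identity` — the pointwise identity on `(0,1)`;
* `cubeSubst_image_boxDilation` — `Φ '' (0,1) = (0,1)` (explicit inverse `t ↦ t^(1/3)`);
* `cubeSubst_isSemialgebraicFunOn` — `3 (t − t⁴)^(−3/4)` is a `ℚ`-semialgebraic function on `(0,1)`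
  (`KZ.isSemialgebraicFunOn_mellinIntegrand` with the one-member family `X₀ − X₀⁴`, exponent `−3/4`,
  constant `3`);
* `stub_cubeSubstitution` — existence of `ρ₁` (its integrability is transported from `r` along `Φ`
  by Mathlib's `integrableOn_image_iff_integrableOn_abs_det_fderiv_smul`) and `r ~ ρ` for EVERY
  representation `ρ` pinned to `[(0,1), 3 (t − t⁴)^(−3/4)]`
  (`KZ.of_sub_of_mem_relations_of_boxDilation` gives `[ρ] − [r] ∈ KZ.relations`, then symmetry).

Nothing else of the line (the fold, the quotient, the untwisting, the lemniscatic normalisation)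
is touched here.

References: M. Kontsevich, D. Zagier, *Periods* (2001), §1.2 rule (2).
-/

noncomputable section

open Set MeasureTheory
open Literature.NumberTheory.Transcendental Literature.ModelTheory.ExponentialFields

namespace Summit.KontsevichZagierPeriods.TerasomaMultiplication.DasGapTwelve

/-- On `(0,1)`: `0 < t − t⁴` (`= t (1 − t³)`). [folklore] -/
theorem cubeSubst_base_pos {t : ℝ} (ht : t ∈ Set.Ioo (0:ℝ) 1) : 0 < t - t ^ 4 :=
  calc (0:ℝ) < t * (1 - t ^ 3) :=
      mul_pos ht.1 (sub_pos.2 (pow_lt_one₀ ht.1.le ht.2 three_ne_zero))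
    _ = t - t ^ 4 := by ring

/-- The pointwise identity of the substitution `x = t³` on `(0,1)` (Jacobian `3t²` included):
`(t³)^(-11/12) (1 − t³)^(-3/4) · 3t² = 3 (t − t⁴)^(-3/4)`. [folklore] -/
theorem cubeSubst_kernel_identity {t : ℝ} (ht : t ∈ Set.Ioo (0:ℝ) 1) :
    (t ^ 3) ^ (-(11:ℝ)/12) * (1 - t ^ 3) ^ (-(3:ℝ)/4) * (((2 + 1 : ℕ) : ℝ) * t ^ 2) =
      3 * (t - t ^ 4) ^ (-(3:ℝ)/4) := by
  have h0 : 0 < t := ht.1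
  have h1t : 0 ≤ 1 - t ^ 3 := sub_nonneg.2 (pow_le_one₀ h0.le ht.2.le)
  have h1 : (t ^ 3) ^ (-(11:ℝ)/12) = t ^ (-(11:ℝ)/4) := by
    rw [← Real.rpow_natCast t 3, ← Real.rpow_mul h0.le]
    norm_num
  have h2 : t ^ (-(11:ℝ)/4) * t ^ 2 = t ^ (-(3:ℝ)/4) := by
    rw [← Real.rpow_natCast t 2, ← Real.rpow_add h0]
    norm_num
  have h3 : t ^ (-(3:ℝ)/4) * (1 - t ^ 3) ^ (-(3:ℝ)/4) = (t - t ^ 4) ^ (-(3:ℝ)/4) := by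
    rw [← Real.mul_rpow h0.le h1t]
    congr 1
    ring
  calc (t ^ 3) ^ (-(11:ℝ)/12) * (1 - t ^ 3) ^ (-(3:ℝ)/4) * (((2 + 1 : ℕ) : ℝ) * t ^ 2)
      = 3 * ((t ^ (-(11:ℝ)/4) * t ^ 2) * (1 - t ^ 3) ^ (-(3:ℝ)/4)) := by
        rw [h1]; push_cast; ring
    _ = 3 * (t - t ^ 4) ^ (-(3:ℝ)/4) := by rw [h2, h3]

/-- The Kummer covering `KZ.boxDilation 0 2 : t ↦ t³` maps `(0,1) ⊂ ℝ¹` onto itself (the inverse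
being `t ↦ t^(1/3)`). [folklore] -/
theorem cubeSubst_image_boxDilation :
    KZ.boxDilation (0 : Fin 1) 2 '' ({x | x 0 ∈ Set.Ioo (0:ℝ) 1} : Set (Fin 1 → ℝ)) =
      {x | x 0 ∈ Set.Ioo (0:ℝ) 1} := by
  ext y
  constructor
  · rintro ⟨x, hx, rfl⟩
    have hx' : x 0 ∈ Set.Ioo (0:ℝ) 1 := hx
    show KZ.boxDilation 0 2 x 0 ∈ Set.Ioo (0:ℝ) 1
    rw [KZ.boxDilation_apply_self]
    exact ⟨pow_pos hx'.1 _, pow_lt_one₀ hx'.1.le hx'.2 (by norm_num)⟩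
  · intro hy
    have hy' : y 0 ∈ Set.Ioo (0:ℝ) 1 := hy
    refine ⟨fun _ => (y 0) ^ ((3 : ℕ) : ℝ)⁻¹, ?_, ?_⟩
    · show (y 0) ^ ((3 : ℕ) : ℝ)⁻¹ ∈ Set.Ioo (0:ℝ) 1
      exact ⟨Real.rpow_pos_of_pos hy'.1 _, Real.rpow_lt_one hy'.1.le hy'.2 (by positivity)⟩
    · funext i
      rw [Subsingleton.elim i 0, KZ.boxDilation_apply_self]
      exact Real.rpow_inv_natCast_pow hy'.1.le (by norm_num)

/-- `3 (t − t⁴)^(−3/4)` is a `ℚ`-semialgebraic function on `(0,1) ⊂ ℝ¹`: it is the Euler–Mellin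
integrand of the one-member family `X₀ − X₀⁴` (positive on `(0,1)`) with rational exponent `−3/4`
and constant `3`. [folklore] -/
theorem cubeSubst_isSemialgebraicFunOn
    (hs : IsSemialgebraic ℚ ({x | x 0 ∈ Set.Ioo (0:ℝ) 1} : Set (Fin 1 → ℝ))) :
    IsSemialgebraicFunOn ℚ ({x | x 0 ∈ Set.Ioo (0:ℝ) 1} : Set (Fin 1 → ℝ))
      (fun x => 3 * (x 0 - (x 0) ^ 4) ^ (-(3:ℝ)/4)) := by
  have hpos : ∀ x ∈ ({x | x 0 ∈ Set.Ioo (0:ℝ) 1} : Set (Fin 1 → ℝ)), ∀ k : Fin 1,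
      0 < MvPolynomial.aeval x ((fun _ : Fin 1 =>
        (MvPolynomial.X 0 - MvPolynomial.X 0 ^ 4 : MvPolynomial (Fin 1) ℚ)) k) := by
    intro x hx _
    simp only [map_sub, map_pow, MvPolynomial.aeval_X]
    exact cubeSubst_base_pos hx
  refine (KZ.isSemialgebraicFunOn_mellinIntegrand hs
    (fun _ : Fin 1 => (MvPolynomial.X 0 - MvPolynomial.X 0 ^ 4 : MvPolynomial (Fin 1) ℚ))
    (fun _ => (-3) / 4) 3 hpos).congr fun x _ => ?_
  rw [KZ.mellinIntegrand_apply]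
  simp only [Fin.prod_univ_one, map_sub, map_pow, MvPolynomial.aeval_X]
  push_cast
  ring

/-- Stub E (entry substitution `x = t³`, one rule-2 move): the crux's left representation
`[(0,1), x^(-11/12)(1-x)^(-3/4)]` is equivalent to `[(0,1), 3(t − t⁴)^(−3/4)]`, a period of the quartic
`v⁴ = t − t⁴` (the Picard curve `X⁴ = Y³ − 1`), and such a representation exists: the pulled-back
integrand `(f ∘ Φ) · |det DΦ|` along `Φ = KZ.boxDilation 0 2` is `3 (t − t⁴)^(−3/4)` on `(0,1)`
(`cubeSubst_kernel_identity`), `Φ (0,1) = (0,1)` (`cubeSubst_image_boxDilation`); existence takes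
the integrability of `r` across `Φ` (`integrableOn_image_iff_integrableOn_abs_det_fderiv_smul`), and
for every pinned `ρ` the move `KZ.of_sub_of_mem_relations_of_boxDilation` gives `[ρ] − [r] ∈ relations`.
[cite: KontsevichZagier2001, §1.2 rule (2)] -/
theorem stub_cubeSubstitution :
    ∀ (r : Literature.NumberTheory.Transcendental.KZ.IntegralRep 1), r.domain = {x | x 0 ∈ Set.Ioo (0:ℝ) 1} → Set.EqOn r.integrand (fun x => (x 0) ^ (-(11:ℝ)/12) * (1 - x 0) ^ (-(3:ℝ)/4)) r.domain → (∃ ρ : Literature.NumberTheory.Transcendental.KZ.IntegralRep 1, ρ.domain = {x | x 0 ∈ Set.Ioo (0:ℝ) 1} ∧ Set.EqOn ρ.integrand (fun x => 3 * (x 0 - (x 0) ^ 4) ^ (-(3:ℝ)/4)) ρ.domain) ∧ ∀ (ρ : Literature.NumberTheory.Transcendental.KZ.IntegralRep 1), ρ.domain = {x | x 0 ∈ Set.Ioo (0:ℝ) 1} → Set.EqOn ρ.integrand (fun x => 3 * (x 0 - (x 0) ^ 4) ^ (-(3:ℝ)/4)) ρ.domain → Literature.NumberTheory.Transcendental.KZ.Equivalent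 r ρ := by
  intro r hr hri
  -- the pulled-back integrand `(f ∘ Φ) · |det DΦ|` is `3 (t − t⁴)^(−3/4)` on `(0,1)`
  have hpull : ∀ x : Fin 1 → ℝ, x 0 ∈ Set.Ioo (0:ℝ) 1 →
      r.integrand (KZ.boxDilation 0 2 x) * (((2 + 1 : ℕ) : ℝ) * x 0 ^ 2) =
        3 * (x 0 - (x 0) ^ 4) ^ (-(3:ℝ)/4) := by
    intro x hx
    have hx3 : KZ.boxDilation 0 2 x ∈ r.domain := by
      rw [hr, ← cubeSubst_image_boxDilation]
      exact Set.mem_image_of_mem _ hx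
    rw [hri hx3]
    show (KZ.boxDilation 0 2 x 0) ^ (-(11:ℝ)/12) * (1 - KZ.boxDilation 0 2 x 0) ^ (-(3:ℝ)/4) * _ = _
    rw [KZ.boxDilation_apply_self]
    exact cubeSubst_kernel_identity hx
  have hS : IsSemialgebraic ℚ ({x | x 0 ∈ Set.Ioo (0:ℝ) 1} : Set (Fin 1 → ℝ)) := by
    rw [← hr]
    exact r.isSemialgebraic_domain
  have hM : MeasurableSet ({x | x 0 ∈ Set.Ioo (0:ℝ) 1} : Set (Fin 1 → ℝ)) :=
    DasGapTwelveNegative.measurableSet_unitIoo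
  have hpos : ∀ x ∈ ({x | x 0 ∈ Set.Ioo (0:ℝ) 1} : Set (Fin 1 → ℝ)), 0 < x 0 := fun x hx => hx.1
  refine ⟨?_, fun ρ hρ hρi => ?_⟩
  · -- existence: integrability is transported from `r` along `Φ = boxDilation 0 2`
    obtain ⟨L, hdet, hL⟩ := KZ.exists_hasFDerivAt_boxDilation (0 : Fin 1) 2
    have key := integrableOn_image_iff_integrableOn_abs_det_fderiv_smul volume hM (f' := L)
      (fun x _ => (hL x).hasFDerivWithinAt) (KZ.injOn_boxDilation 0 2 hpos) r.integrand
    rw [cubeSubst_image_boxDilation] at key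
    have hr1 : IntegrableOn r.integrand ({x | x 0 ∈ Set.Ioo (0:ℝ) 1} : Set (Fin 1 → ℝ)) := by
      rw [← hr]
      exact r.integrableOn
    have hint : IntegrableOn (fun x : Fin 1 → ℝ => 3 * (x 0 - (x 0) ^ 4) ^ (-(3:ℝ)/4))
        ({x | x 0 ∈ Set.Ioo (0:ℝ) 1} : Set (Fin 1 → ℝ)) := by
      refine (integrableOn_congr_fun (fun x hx => ?_) hM).1 (key.1 hr1)
      rw [hdet, abs_of_pos (by have := hpos x hx; positivity), smul_eq_mul, mul_comm]
      exact hpull x hx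
    exact ⟨⟨{x | x 0 ∈ Set.Ioo (0:ℝ) 1}, fun x => 3 * (x 0 - (x 0) ^ 4) ^ (-(3:ℝ)/4), hS,
      cubeSubst_isSemialgebraicFunOn hS, hint⟩, rfl, fun _ _ => rfl⟩
  · -- equivalence: one rule-(2) move `[ρ] − [r] ∈ relations`, then symmetry
    refine KZ.Equivalent.symm ?_
    refine KZ.of_sub_of_mem_relations_of_boxDilation (0 : Fin 1) 2 (r := ρ) (r' := r)
      (fun x hx => ?_) ?_ (fun x hx => ?_)
    · rw [hρ] at hx
      exact hx.1
    · rw [hρ, hr, cubeSubst_image_boxDilation]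
    · have hx' : x 0 ∈ Set.Ioo (0:ℝ) 1 := by
        rw [hρ] at hx
        exact hx
      exact (hρi hx).trans (hpull x hx').symm

end Summit.KontsevichZagierPeriods.TerasomaMultiplication.DasGapTwelve

end
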